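import Mathlib
import HarnessLib
import Summits.ValiantsHypothesis.ValiantsHypothesis.Theorems.MonotoneRestorationOrbitRestorationQPGradedCatalecticant
import Summits.ValiantsHypothesis.ValiantsHypothesis.Theorems.MonotoneRestorationOrbitRestorationQPSmlAffineResidue

/-!
# The graded catalecticant stratum PER LEVEL and the sharpened wild residue of A_∞ with SIX exclusions
(crux `OrbitRestorationQP`, stmt-ValiantsHypothesis-18293 — line `depth-three-rung`, registered stub `stub_sigmaPiSigmaValue` = A_∞)

Namespace `Summit.ValiantsHypothesis.ValiantsHypothesis.Theorems.DerivativeTower` / `…SmlAffineRestoration`.  Definition-free.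

`…SmlAffineResidue.lean` (`sigmaPiSigmaValue_of_sharpResidue₅`) records in the kernel that whoever attacks the residue of A_∞ may
assume the matrix-symmetric `p ∈ PDClass (fun _ => 1) n c` (i) has no groupable depth-three representation, (ii) is not killed
by some double-difference derivation, (iii)/(iv) is not invariant under the within-row (within-column) permutations of some row
(column), (v)/(vi') has no affine column- or row-set-multilinear expression with `≤ n^c + c` product gates.  The unconditional
DERIVATIVE-TOWER stratum (`DerivativeTower.smallGradedDerivChain_restoration`, `…GradedCatalecticant.lean`: every
matrix-symmetric family all of whose homogeneous components have derivative spaces of dimension `≤ n^c + c` — graded polynomial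
catalecticant rank; contains `ΣΛΣ` over affine forms and sums of polynomially many products of boundedly many powers) was stated
for FAMILIES only and is therefore missing from that list.  Its constant is in fact uniform (`n₀(c)! + k(c) + 7`), so:

* `smallGradedDerivChain_restorable_uniform` — **per level, one constant per exponent**: `∀ c ∃ c' ∀ n p`, a matrix-symmetric `p`
  at level `n` whose homogeneous components have all derivative spaces of dimension `≤ n^c + c` is `QPOrbitRestorable c' n p`;
* `sigmaPiSigmaValue_of_sharpResidue₆` — **SHARPER RESIDUE, SIX EXCLUSIONS ⇒ A_∞**: the registered stub follows from restoring,
  with one constant per exponent `c`, the matrix-symmetric `p ∈ PDClass (fun _ => 1) n c` satisfying (i)–(vi') AND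
  (vii) SOME derivative space of SOME homogeneous component of `p` has dimension `> n^c + c` (large graded catalecticant rank
  somewhere; stated as `FiniteDimensional _ → n^c + c < finrank _`).

Honest label: bookkeeping over landed theorems (the census in kernel form); no stub closed; VP ≠ VNP untouched. [folklore]
-/

noncomputable section

open scoped Classical

-- `Summit.ValiantsHypothesis.ValiantsHypothesis.…` is the tree's single-conjunct layout (Sub = Summit).
set_option linter.dupNamespace false

namespace Summit.ValiantsHypothesis.ValiantsHypothesis.Theorems

namespace DerivativeTower

open MvPolynomial Finset Equiv OrbitRestorationQPDepthThreeRung WaringJennrich LevelStructure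

/-- **GRADED POLYNOMIAL CATALECTICANT RANK ⇒ RESTORABLE, PER LEVEL, ONE CONSTANT PER EXPONENT.**  For every `c` there is `c'`
such that every matrix-symmetric `p` at any level `n` all of whose homogeneous components have every derivative space of
dimension `≤ n^c + c` is `QPOrbitRestorable c' n p` (levels `n ≥ n₀(c)` by the alt-spanning property of small matrix-stable
modules and the graded derivative tower, smaller levels by brute force). [folklore] -/
theorem smallGradedDerivChain_restorable_uniform (c : ℕ) : ∃ c' : ℕ,
    ∀ (n : ℕ) (p : MvPolynomial (Fin n × Fin n) ℂ),
      (∀ σ τ : Perm (Fin n), rename (fun q : Fin n × Fin n => (σ q.1, τ q.2)) p = p) →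
      (∀ e m, FiniteDimensional ℂ (derivChain (homogeneousComponent e p) m) ∧
        Module.finrank ℂ (derivChain (homogeneousComponent e p) m) ≤ n ^ c + c) →
      QPOrbitRestorable c' n p := by
  obtain ⟨k, n₀, hk⟩ := AltFix.smallModules_altSpanning c
  refine ⟨n₀.factorial + k + 7, fun n p hsym hrank => ?_⟩
  by_cases hn : n₀ ≤ n
  · refine Restorable.qpOrbitRestorable_mono (by omega)
      (qpOrbitRestorable_of_smallGradedDerivChain (k := k) (r := n ^ c + c) (D := p.totalDegree)
        (fun W hW hdim hst => hk n hn W hW hdim fun ρ w' hw' => by rw [ren_eq_mact]; exact hst ρ ρ w' hw')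
        le_rfl hrank fun σ τ => ?_)
    rw [mact_apply]; exact hsym σ τ
  · refine Restorable.qpOrbitRestorable_mono ?_
      (Restorable.qpOrbitRestorable_of_invariant p fun σ => ValueOrbit.ren_eq_of_matrixSymmetric hsym σ)
    have : n.factorial ≤ n₀.factorial := Nat.factorial_le (by omega)
    omega

end DerivativeTower

namespace SmlAffineRestoration

open MvPolynomial Finset Equiv Literature.Computability.AlgebraicComplexity OrbitRestorationQPDepthThreeRung DerivativeTower

/-- **SHARPER RESIDUE, SIX EXCLUSIONS ⇒ A_∞.**  The registered stub `stub_sigmaPiSigmaValue` follows from restoring, with one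
constant per exponent `c`, the matrix-symmetric `p ∈ PDClass (fun _ => 1) n c` that have no groupable representation, are not
killed by some double-difference derivation, are not invariant under the within-row permutations of some row nor under the
within-column permutations of some column, have no affine column-sml and no affine row-sml expression with at most `n^c + c`
product gates, AND have some homogeneous component with some derivative space of dimension `> n^c + c` (the graded catalecticant
stratum `smallGradedDerivChain_restorable_uniform` removed).  Conclusion = the stub's signature verbatim. [folklore] -/
theorem sigmaPiSigmaValue_of_sharpResidue₆
    (hW : ∀ c : ℕ, ∃ c' : ℕ, ∀ (n : ℕ) (p : MvPolynomial (Fin n × Fin n) ℂ),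
      (∀ σ τ : Perm (Fin n), rename (fun q : Fin n × Fin n => (σ q.1, τ q.2)) p = p) →
      PDClass (fun _ => 1) n c p → ¬ GroupableUpTo 0 n c p →
      (∃ a a' b b' : Fin n, pderiv (a, b) p - pderiv (a', b) p - pderiv (a, b') p + pderiv (a', b') p ≠ 0) →
      (∃ (i : Fin n) (τ : Perm (Fin n)),
        rename (fun q : Fin n × Fin n => if q.1 = i then (q.1, τ q.2) else q) p ≠ p) →
      (∃ (j : Fin n) (τ : Perm (Fin n)),
        rename (fun q : Fin n × Fin n => if q.2 = j then (τ q.1, q.2) else q) p ≠ p) →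
      (¬ ∃ (s : ℕ) (β : Fin s → Fin n → ℂ) (α : Fin s → Fin n → Fin n → ℂ), s ≤ n ^ c + c ∧
        p = ∑ t : Fin s, ∏ b : Fin n, (C (β t b) + ∑ a : Fin n, C (α t b a) * X (a, b))) →
      (¬ ∃ (s : ℕ) (β : Fin s → Fin n → ℂ) (α : Fin s → Fin n → Fin n → ℂ), s ≤ n ^ c + c ∧
        p = ∑ t : Fin s, ∏ a : Fin n, (C (β t a) + ∑ b : Fin n, C (α t a b) * X (a, b))) →
      (∃ e m : ℕ, FiniteDimensional ℂ (derivChain (homogeneousComponent e p) m) →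
        n ^ c + c < Module.finrank ℂ (derivChain (homogeneousComponent e p) m)) →
      QPOrbitRestorable c' n p) :
    ∀ f : (n : ℕ) → MvPolynomial (Fin n × Fin n) ℂ, IsMatrixSymmetric f →
      (∃ c : ℕ, ∀ n : ℕ, PDClass (fun _ => 1) n c (f n)) →
      ∃ c : ℕ, ∀ n : ℕ, QPOrbitRestorable c n (f n) := by
  refine sigmaPiSigmaValue_of_sharpResidue₅ fun c => ?_
  obtain ⟨c', hc'⟩ := hW c
  obtain ⟨c₁, hc₁⟩ := smallGradedDerivChain_restorable_uniform c
  refine ⟨max c' c₁, fun n p hsym hPD hng hD hrow hcol hC hR => ?_⟩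
  by_cases hcat : ∀ e m, FiniteDimensional ℂ (derivChain (homogeneousComponent e p) m) ∧
      Module.finrank ℂ (derivChain (homogeneousComponent e p) m) ≤ n ^ c + c
  · exact Restorable.qpOrbitRestorable_mono (le_max_right _ _) (hc₁ n p hsym hcat)
  · have hbig : ∃ e m : ℕ, FiniteDimensional ℂ (derivChain (homogeneousComponent e p) m) →
        n ^ c + c < Module.finrank ℂ (derivChain (homogeneousComponent e p) m) := by
      push Not at hcat
      obtain ⟨e, m, hem⟩ := hcat
      exact ⟨e, m, fun hfd => hem hfd⟩
    exact Restorable.qpOrbitRestorable_mono (le_max_left _ _) (hc' n p hsym hPD hng hD hrow hcol hC hR hbig)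

end SmlAffineRestoration

end Summit.ValiantsHypothesis.ValiantsHypothesis.Theorems

end
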